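import Summits.ResolutionOfSingularities.ResolutionOfSingularities.Theorems.FrobeniusClosingPatchingRelPerfectDepthLegalRestartPrefix
import Summits.ResolutionOfSingularities.ResolutionOfSingularities.Theorems.FrobeniusClosingPatchingRelPerfectDepthLegalRegularLocus
import Literature.AlgebraicGeometry.Resolution.EmbeddedResolutionExcellentSurfacesHistory
import Literature.AlgebraicGeometry.Resolution.StrictNormalCrossingsHasSNC
import Literature.AlgebraicGeometry.Resolution.MaximalPoints
import Mathlib.Topology.NoetherianSpace
import HarnessLib

/-!
# Crux `PatchingRelPerfect` (stmt-ResolutionOfSingularities-16161), chain W5.2 — T6-E1b residual, the `SingCentres₃`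
# discharge (RESTART loop): the RESTART's inputs — boundary presentation, boundary off the regular locus, no component of the
# unfrozen part inside the boundary, dimension

[OURS · L1 W5.2 · `SingCentres₃` discharge = RESTART AT THE FIRST REGULAR COMPONENT (res-L1-w52-plan-1 RULING R4 (3); res-type-049;
OWNER NOTE O3.1), brick R5 «restart inputs», against the hypotheses of the tree's F-72
`CossartJannsenSaito2020_canonicalSequence_history`] Fact-free; NOT statements of the manuscript under review.

THE POINT. To RESTART the CJS construction (F-72) on the unfrozen part `Y` of a strict transform inside the CURRENT regular
threefold `Zc` with the CURRENT s.n.c. boundary `Bc`, F-72's start hypotheses must be met: the boundary presented as an injective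
`ℕ`-family of its IRREDUCIBLE COMPONENTS (`exists_boundary_presentation`: the closures of the maximal points of the s.n.c. set,
tree `IsStrictNormalCrossingsDivisor.exists_hasSNC`), `dim Y ≤ 2` (`topologicalKrullDim_subscheme_le_two`), and NO IRREDUCIBLE
COMPONENT OF `Y` INSIDE THE BOUNDARY — which holds because along a Sing-centred sequence the boundary (exceptional divisors and
their transforms) stays OFF the preimage of the regular locus `U₀` (`seq_boundary_disjoint`), while the points of the strict
transform over `U₀` are DENSE (brick R2), and every irreducible component of a Noetherian space contains a non-empty open subset
(Stacks 0052) (`forall_irreducibleComponents_not_subset`).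

AI-written; AI review is weaker than expert review.

## References
* V. Cossart, U. Jannsen, S. Saito, LNM 2270 (2020), Def. 4.3/4.4, Thm. 6.9 (a) (setup (E)), Cor. 6.26. [CossartJannsenSaito2020]
* The Stacks Project, Tags 0052, 0BIA, 02OS. [StacksProject]
-/

-- `Summit.<Summit>.<Sub>.Theorems` with `Sub = Summit` (single-conjunct summit, D-0017)
set_option linter.dupNamespace false

noncomputable section

open CategoryTheory CategoryTheory.Limits AlgebraicGeometry TopologicalSpace IsLocalRing
open Literature.AlgebraicGeometry.Resolution Scheme.IdealSheafData
open Literature.AlgebraicGeometry.Resolution.CJSHistory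

namespace Summit.ResolutionOfSingularities.ResolutionOfSingularities.Theorems

universe u

namespace LegalRestart

variable {Z : Scheme.{u}}

/-! ## §1 The irreducible components of a closed set: closures of its maximal points -/

/-- **The closure of a maximal point of a closed `S` is an irreducible component of `S`** in the sense of F-72's
`CJSHistory.irreducibleComponentsOf` (maximal irreducible subsets of `Z` inside `S`): an irreducible `T' ⊇ cl{η}` inside `S` has
a generic point of its closure specialising to `η`, hence equal to it. [cite: StacksProject, Tag 0BIA] -/
theorem closure_singleton_mem_irreducibleComponentsOf {S : Set Z} (hS : IsClosed S) {η : Z} (hη : η ∈ maxPoints S) :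
    closure {η} ∈ irreducibleComponentsOf Z S := by
  refine ⟨⟨isIrreducible_singleton.closure, closure_minimal (Set.singleton_subset_iff.mpr hη.1) hS⟩, ?_⟩
  rintro T' ⟨hT'irr, hT'S⟩ hle
  -- the generic point `ξ` of `cl T'` specialises to `η ∈ cl T'`, and lies in `S`
  obtain ⟨ξ, hξ⟩ := QuasiSober.sober hT'irr.closure isClosed_closure
  have hηT : η ∈ closure T' := subset_closure (hle (subset_closure (Set.mem_singleton η)))
  have hξη : ξ ⤳ η := hξ.specializes hηT
  have hξS : ξ ∈ S := closure_minimal hT'S hS hξ.mem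
  have hξeq : ξ = η := hη.2 ξ hξS hξη
  calc T' ⊆ closure T' := subset_closure
    _ = closure {ξ} := hξ.symm
    _ = closure {η} := by rw [hξeq]

/-- **An s.n.c. set on a regular Noetherian scheme is presented by an injective finite family of its irreducible components**
(the shape of F-72's boundary hypothesis): `B : ℕ → Set Z`, a counter `k`, `⋃_j B_j = S`, `B_j = ∅` for `j ≥ k`, members
`j < k` pairwise distinct irreducible components of `S`, all members closed. [cite: CossartJannsenSaito2020, Def. 4.3 (p. 53)]
[cite: StacksProject, Tag 0BIA] -/
theorem exists_boundary_presentation [IsNoetherian Z] (hZ : Scheme.IsRegular Z) {S : Set Z}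
    (hS : IsStrictNormalCrossingsDivisor Z S) :
    ∃ (B : ℕ → Set Z) (k : ℕ), (⋃ j, B j) = S ∧ (∀ j, k ≤ j → B j = ∅) ∧
      (∀ j < k, B j ∈ irreducibleComponentsOf Z (⋃ j, B j)) ∧ Set.InjOn B (Set.Iio k) ∧ (∀ j, IsClosed (B j)) := by
  classical
  obtain ⟨E, -, hE1, -, hEU⟩ := hS.exists_hasSNC hZ
  -- the finite set of supports, listed without repetition
  let Sf : Finset (Set Z) := (E.map fun D => ((D.support : Closeds Z) : Set Z)).toFinset
  let L : List (Set Z) := Sf.toList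
  have hLnodup : L.Nodup := Finset.nodup_toList Sf
  have hmemL : ∀ {s : Set Z}, s ∈ L ↔ ∃ D ∈ E, ((D.support : Closeds Z) : Set Z) = s := by
    intro s
    simp only [L, Sf, Finset.mem_toList, List.mem_toFinset, List.mem_map]
  let B : ℕ → Set Z := fun j => if h : j < L.length then L[j] else ∅
  have hBlt : ∀ {j} (h : j < L.length), B j = L[j] := fun {j} h => by
    show (if h : j < L.length then L[j] else ∅) = L[j]
    rw [dif_pos h]
  have hBge : ∀ {j}, L.length ≤ j → B j = ∅ := fun {j} h => by
    show (if h : j < L.length then L[j] else ∅) = ∅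
    rw [dif_neg (not_lt.mpr h)]
  -- the union is `S`
  have hU : (⋃ j, B j) = S := by
    rw [← hEU]
    ext z
    simp only [Set.mem_iUnion, exists_prop]
    constructor
    · rintro ⟨j, hj⟩
      by_cases h : j < L.length
      · rw [hBlt h] at hj
        obtain ⟨D, hD, hDs⟩ := hmemL.mp (List.getElem_mem h)
        exact ⟨D, hD, by rw [← hDs] at hj; exact hj⟩
      · rw [hBge (not_lt.mp h)] at hj
        exact absurd hj (Set.notMem_empty z)
    · rintro ⟨D, hD, hz⟩
      obtain ⟨j, hj, hjD⟩ := List.mem_iff_getElem.mp (hmemL.mpr ⟨D, hD, rfl⟩)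
      exact ⟨j, by rw [hBlt hj, hjD]; exact hz⟩
  refine ⟨B, L.length, hU, fun j hj => hBge hj, fun j hj => ?_, ?_, fun j => ?_⟩
  · -- members are irreducible components
    rw [hU, hBlt hj]
    obtain ⟨D, hD, hDs⟩ := hmemL.mp (List.getElem_mem hj)
    obtain ⟨η, hη, rfl⟩ := hE1 D hD
    rw [← hDs, Scheme.IdealSheafData.coe_support_vanishingIdeal]
    exact closure_singleton_mem_irreducibleComponentsOf hS.1 hη
  · -- pairwise distinct
    intro i hi j hj hij
    have hi' : i < L.length := hi
    have hj' : j < L.length := hj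
    rw [hBlt hi', hBlt hj'] at hij
    exact (hLnodup.getElem_inj_iff).mp hij
  · -- closed
    by_cases h : j < L.length
    · rw [hBlt h]
      obtain ⟨D, -, hDs⟩ := hmemL.mp (List.getElem_mem h)
      rw [← hDs]
      exact D.support.isClosed
    · rw [hBge (not_lt.mp h)]; exact isClosed_empty

/-! ## §2 The boundary stays off the regular locus -/

/-- **Along a Sing-centred sequence the boundary stays off `σ⁻¹U₀`** when it starts so (`U₀` an open meeting `X` in regular
points of its reduced structure, densely): no centre meets `σ⁻¹U₀` (brick R2), so neither do the exceptional divisors and their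
transforms. [cite: CossartJannsenSaito2020, Thm. 6.9 (a)] [cite: StacksProject, Tag 02OS] -/
theorem seq_boundary_disjoint {E : Scheme.{u}} {X B : Set E} (hX : IsClosed X) (U₀ : E.Opens)
    (hreg : ∀ x ∈ X ∩ (U₀ : Set E), IsRegularLocalRing (E.presheaf.stalk x ⧸ stalkIdeal (vanishingIdeal ⟨X, hX⟩) x))
    (hdense : X ⊆ closure (X ∩ (U₀ : Set E))) (hB : Disjoint B (U₀ : Set E)) :
    ∀ {Z' : Scheme.{u}} {σ : Z' ⟶ E} {X' B' : Set Z'}, IsBPermissibleSequence X B σ X' B' →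
      Disjoint B' (σ ⁻¹' (U₀ : Set E)) := by
  intro Z' σ X' B' h
  induction h with
  | refl => simpa using hB
  | @blowup Z' Z'' σ X' B' h C τ hτ hreg' hsub hsing hperm hnc ih =>
    obtain ⟨hX'c, hiso, -, hI, -⟩ := seq_over_regularLocus hX U₀ hreg hdense h
    have hcl : (⟨closure X', isClosed_closure⟩ : Closeds Z') = ⟨X', hX'c⟩ := Closeds.ext hX'c.closure_eq
    have hCX : (C.support : Set Z') ⊆ X' := support_subset_of_hsub hX'c hsub
    refine Set.disjoint_left.mpr fun z hz hzU => ?_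
    have hzU' : σ (τ z) ∈ (U₀ : Set E) := by simpa [Scheme.Hom.comp_apply] using hzU
    rcases hz with hzB | hzC
    · exact Set.disjoint_left.mp ih hzB hzU'
    · refine hsing (τ z) hzC ?_
      rw [hcl]
      exact isRegularLocalRing_quotient_over hX U₀ hreg hX'c hiso hI ⟨hCX hzC, hzU'⟩

/-! ## §3 The unfrozen part: dimension, and no component inside the boundary -/

/-- **`dim ≤ 2`** for the reduced closed subscheme on a closed `Y ⊊ Zc` of an integral threefold. [folklore] -/
theorem topologicalKrullDim_subscheme_le_two [IsIntegral Z] (hdim : topologicalKrullDim Z = 3) {Y : Set Z} (hY : IsClosed Y)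
    (hYne : Y ≠ Set.univ) : topologicalKrullDim ↥((vanishingIdeal (⟨Y, hY⟩ : Closeds Z)).subscheme) ≤ 2 := by
  have hlt := Literature.Topology.topologicalKrullDim_lt_of_isClosed_ssubset hY hYne (2 + 1)
    (by rw [hdim]; exact_mod_cast (by norm_num : (3 : ℕ) < 2 + 1 + 1))
  rw [Nat.cast_add_one] at hlt
  have hdimY : topologicalKrullDim Y ≤ 2 := by exact_mod_cast (ENat.WithBot.lt_add_one_iff.mp hlt)
  rw [topologicalKrullDim_subscheme_vanishingIdeal]
  exact_mod_cast hdimY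

/-- A relatively open piece of a set inherits density of a relatively open subset: `X' ⊆ cl (X' ∩ V)` and `Y = X' ∩ W` (`W` open)
give `Y ⊆ cl (Y ∩ V)`. [folklore] -/
theorem subset_closure_inter_of_piece {X' V W Y : Set Z} (hW : IsOpen W) (hY : X' ∩ W = Y) (hden : X' ⊆ closure (X' ∩ V)) :
    Y ⊆ closure (Y ∩ V) := by
  intro y hy
  have hy' : y ∈ X' ∩ W := by rw [hY]; exact hy
  have h1 : y ∈ W ∩ closure (X' ∩ V) := ⟨hy'.2, hden hy'.1⟩
  have h2 := hW.inter_closure h1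
  refine closure_mono (fun z hz => ?_) h2
  obtain ⟨hzW, hzX, hzV⟩ := hz
  exact ⟨by rw [← hY]; exact ⟨hzX, hzW⟩, hzV⟩

/-- **NO IRREDUCIBLE COMPONENT OF THE UNFROZEN PART LIES IN THE BOUNDARY** (F-72's start hypothesis): for the reduced closed
subscheme `ι : S ↪ Zc` on a closed `Y` whose points over `U₀` are DENSE (`Y ⊆ cl (Y ∩ σ⁻¹U₀)`), and a boundary `Bc` off `σ⁻¹U₀`,
every irreducible component `T` of `S` contains a non-empty open subset (Stacks 0052 (3)), which meets `ι⁻¹σ⁻¹U₀`, at a point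
not in `ι⁻¹Bc`. [cite: CossartJannsenSaito2020, Thm. 6.9 (setup (E))] [cite: StacksProject, Tag 0052] -/
theorem forall_irreducibleComponents_not_subset [IsNoetherian Z] {E : Scheme.{u}} (σ : Z ⟶ E) (U₀ : E.Opens) {Y : Set Z}
    (hY : IsClosed Y) (hden : Y ⊆ closure (Y ∩ σ ⁻¹' (U₀ : Set E))) {Bc : Set Z}
    (hB : Disjoint Bc (σ ⁻¹' (U₀ : Set E))) :
    ∀ T ∈ irreducibleComponents ↥((vanishingIdeal (⟨Y, hY⟩ : Closeds Z)).subscheme),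
      ¬ T ⊆ (vanishingIdeal (⟨Y, hY⟩ : Closeds Z)).subschemeι ⁻¹' Bc := by
  set I := vanishingIdeal (⟨Y, hY⟩ : Closeds Z) with hI
  have hrange : Set.range I.subschemeι = Y := range_subschemeι_vanishingIdeal ⟨Y, hY⟩
  haveI : NoetherianSpace ↥(I.subscheme) := I.subschemeι.isClosedEmbedding.isInducing.noetherianSpace
  intro T hT hTB
  obtain ⟨o, ho, hone, hoT⟩ := NoetherianSpace.exists_isOpen_nonempty_subset_irreducibleComponent T hT
  -- `o = ι⁻¹O` for an open `O` of `Z`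
  obtain ⟨O, hO, hOo⟩ := I.subschemeι.isClosedEmbedding.isInducing.isOpen_iff.mp ho
  obtain ⟨t, ht⟩ := hone
  have htO : I.subschemeι t ∈ Y ∩ O := ⟨hrange ▸ Set.mem_range_self t, by
    have : t ∈ I.subschemeι ⁻¹' O := by rw [hOo]; exact ht
    exact this⟩
  -- a point of `Y ∩ O` over `U₀`
  have hcl : I.subschemeι t ∈ closure (Y ∩ σ ⁻¹' (U₀ : Set E)) := hden htO.1
  obtain ⟨y, hyO, hyY, hyU⟩ := mem_closure_iff.mp hcl O hO htO.2
  obtain ⟨t', ht'⟩ : y ∈ Set.range I.subschemeι := by rw [hrange]; exact hyY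
  have ht'o : t' ∈ o := by
    rw [← hOo]
    show I.subschemeι t' ∈ O
    rw [ht']; exact hyO
  have ht'B : I.subschemeι t' ∈ Bc := hTB (hoT ht'o)
  rw [ht'] at ht'B
  exact Set.disjoint_left.mp hB ht'B hyU

end LegalRestart

end Summit.ResolutionOfSingularities.ResolutionOfSingularities.Theorems

end
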